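import Summits.CriticalPhenomena.Ising3DConformalLimit.Theses.LatticeSDPCertificates
import Summits.CriticalPhenomena.Ising3DConformalLimit.Theorems.LatticeSDPCertificatesWindowBelowHalf
import Literature.Probability.LatticeModels.LatticeBootstrapFeasible
import HarnessLib

/-!
# Route `LatticeSDPCertificates`, crux `CertifiedWindow` (stmt-CriticalPhenomena-5504):
# the crux is a statement about ONE scale factor at ONE relative depth

`CertifiedWindow` (CW) asks: for all window constants `cw, Cw > 0` there are `ε, c > 0`, `k ≥ 1`
such that for every `R` and every probability boundary law `ν`, if the level-`kR` mixture
functional `E = boundaryLawFunctional 3 (kR) β_c(3) ν` (`A ↦ ∫ ⟨σ_A⟩^η_{Λ_{kR}} dν(η)`) satisfies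
the lattice-bootstrap rows `LatticeBootstrapFeasible (kR) cw Cw E` (by `Iff.rfl` the hypothesis
rows of the route decl), then WINDOW holds for `E` up to scale `R`:
`c (n/m)^{-(3/2-ε)} E{0, m e₁} ≤ E{0, n e₁}`, `1 ≤ m ≤ n ≤ R`.

This helper file (`--supports stmt-CriticalPhenomena-5504`; nothing here proves or refutes the
crux, which is an open problem) records, sorry-free, the crux-level analogue of
`windowBelowHalf_iff_scaleFactor` (support item `WindowBelowHalf`, same route):

* `axisWindow_of_oneStep` — the real-variable core: a positive function `g` on `{1,…,L}`,
  antitone there, with a uniform `q`-adic one-step bound `κ g(n) ≤ g(q n)` for `n ≤ R`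
  (`q ≥ 2`, `q R ≤ L`) satisfies `κ (n/m)^{log_q κ} g(m) ≤ g(n)` for `1 ≤ m ≤ n ≤ R`
  (iterate to the scales `q^j m`, fill in by monotonicity INSIDE `{1,…,L}` — this is where the
  relative depth `k ≥ q` of the crux is spent).
* `feasible_axisWindow_of_oneStep` — the same for a row-feasible level-`L` functional `E`
  (rows used: Griffiths/window positivity `E{0,x} > 0` and the Messager–Miracle-Solé axis row 5).
* `certifiedWindow_of_oneStep` / `oneStep_of_certifiedWindow` / `certifiedWindow_iff_oneStep` —
  **CW holds iff for SOME integer `q ≥ 2`, SOME `κ > q^{-3/2}` and SOME relative depth `k ≥ q`,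
  every row-feasible level-`kR` boundary-law functional obeys the single inequality
  `κ E{0, n e₁} ≤ E{0, q n e₁}` for all `1 ≤ n ≤ R`** (uniformly in `R` and `ν`). So an
  `R`-uniform certificate of the route only ever has to certify ONE scale-comparison functional
  at ONE scale factor; the exponent bookkeeping (`ε = 3/2 + log_q κ > 0`, `c = κ`) is done here
  once and for all.
* `stub_oneStepCriterion` — the registered stub of the crux skeleton (rev 2) that this file
  discharges BY NAME (`= certifiedWindow_of_oneStep`).

References: A. Messager, S. Miracle-Solé, J. Stat. Phys. 17 (1977) [MessagerMiracleSoleJSP1977]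
(row 5); M. Cho, X. Sun, JHEP 11 (2023) 047 [ChoSun2023] (the relaxation whose feasible points are
the boundary-law functionals); the reduction itself is elementary [folklore].
-/

noncomputable section

namespace Summit.CriticalPhenomena.Ising3DConformalLimit.Theorems

open Literature.Probability.LatticeModels MeasureTheory
open Summit.CriticalPhenomena.Ising3DConformalLimit.Theses.LatticeSDPCertificates

/-! ### The real-variable core -/

/-- Iterating a `q`-adic one-step bound valid for `n ≤ R`: if `κ g(n) ≤ g(q n)` whenever
`1 ≤ n ≤ R` (`κ ≥ 0`, `q ≥ 1`), then `κ^j g(m) ≤ g(q^j m)` as long as all intermediate scales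
`q^i m`, `i < j`, are `≤ R`. [folklore] -/
theorem oneStep_iterate {g : ℕ → ℝ} {q R : ℕ} {κ : ℝ} (hκ : 0 ≤ κ)
    (hstep : ∀ n : ℕ, 1 ≤ n → n ≤ R → κ * g n ≤ g (q * n))
    {m : ℕ} (hm : 1 ≤ m) (hq : 1 ≤ q) :
    ∀ j : ℕ, (∀ i : ℕ, i < j → q ^ i * m ≤ R) → κ ^ j * g m ≤ g (q ^ j * m) := by
  intro j
  induction j with
  | zero => intro _; simp
  | succ j ih =>
    intro hj
    have hprev : κ ^ j * g m ≤ g (q ^ j * m) := ih fun i hi => hj i (Nat.lt_succ_of_lt hi)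
    have hqj : 1 ≤ q ^ j * m := Nat.mul_pos (Nat.pow_pos (by omega)) hm
    calc κ ^ (j + 1) * g m = κ * (κ ^ j * g m) := by ring
      _ ≤ κ * g (q ^ j * m) := mul_le_mul_of_nonneg_left hprev hκ
      _ ≤ g (q * (q ^ j * m)) := hstep _ hqj (hj j (Nat.lt_succ_self j))
      _ = g (q ^ (j + 1) * m) := by rw [show q * (q ^ j * m) = q ^ (j + 1) * m by ring]

/-- **One scale factor gives the window (real-variable core).** Let `g : ℕ → ℝ` be positive and
antitone on `{1,…,L}`, let `q ≥ 2`, `q R ≤ L`, and suppose `κ g(n) ≤ g(q n)` for all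
`1 ≤ n ≤ R` with `κ > 0`. Then `κ (n/m)^{log_q κ} g(m) ≤ g(n)` for all `1 ≤ m ≤ n ≤ R`.
Proof: `κ ≤ 1` by monotonicity; take the least `j` with `n ≤ q^j m`; the intermediate scales
`q^i m < n ≤ R` (`i < j`) are admissible, so `κ^j g(m) ≤ g(q^j m) ≤ g(n)` (the last step by
monotonicity, `q^j m ≤ q n ≤ q R ≤ L`), and `(n/m)^{log_q κ} ≤ (q^{j-1})^{log_q κ} = κ^{j-1}`.
[folklore] -/
theorem axisWindow_of_oneStep {g : ℕ → ℝ} {q R L : ℕ} {κ : ℝ} (hq : 2 ≤ q) (hκ : 0 < κ)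
    (hL : q * R ≤ L)
    (hpos : ∀ n : ℕ, 1 ≤ n → n ≤ L → 0 < g n)
    (hanti : ∀ a b : ℕ, 1 ≤ a → a ≤ b → b ≤ L → g b ≤ g a)
    (hstep : ∀ n : ℕ, 1 ≤ n → n ≤ R → κ * g n ≤ g (q * n)) :
    ∀ m n : ℕ, 1 ≤ m → m ≤ n → n ≤ R →
      κ * ((n : ℝ) / m) ^ Real.logb q κ * g m ≤ g n := by
  intro m n hm hmn hnR
  have hq1 : (1 : ℝ) < q := by exact_mod_cast hq
  have hq0 : (0 : ℝ) < q := by linarith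
  have hm0 : (0 : ℝ) < m := by exact_mod_cast hm
  have hmR : m ≤ R := hmn.trans hnR
  have hRL : R ≤ L := le_trans (Nat.le_mul_of_pos_left R (by omega)) hL
  -- `κ ≤ 1` from the step at `m` and monotonicity between `m` and `q m ≤ q R ≤ L`
  have hκ1 : κ ≤ 1 := by
    have h1 : κ * g m ≤ g (q * m) := hstep m hm hmR
    have h2 : g (q * m) ≤ g m :=
      hanti m (q * m) hm (Nat.le_mul_of_pos_left m (by omega))
        ((Nat.mul_le_mul_left q hmR).trans hL)
    have hgm : 0 < g m := hpos m hm (hmR.trans hRL)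
    nlinarith [h1.trans h2]
  have hlogb : Real.logb q κ ≤ 0 := Real.logb_nonpos hq1 hκ.le hκ1
  have hqκ : (q : ℝ) ^ Real.logb q κ = κ := Real.rpow_logb hq0 hq1.ne' hκ
  -- the least `j` with `n ≤ q^j m`
  have hex : ∃ j : ℕ, n ≤ q ^ j * m := by
    refine ⟨n, ?_⟩
    calc n ≤ 2 ^ n := Nat.lt_two_pow_self.le
      _ ≤ q ^ n := Nat.pow_le_pow_left hq n
      _ ≤ q ^ n * m := Nat.le_mul_of_pos_right _ hm
  obtain ⟨j, hj, hjmin⟩ : ∃ j : ℕ, n ≤ q ^ j * m ∧ ∀ i : ℕ, i < j → ¬ n ≤ q ^ i * m :=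
    ⟨Nat.find hex, Nat.find_spec hex, fun i hi => Nat.find_min hex hi⟩
  -- iterate: all intermediate scales are `< n ≤ R`
  have hiter : κ ^ j * g m ≤ g (q ^ j * m) :=
    oneStep_iterate hκ.le hstep hm (by omega) j fun i hi => by
      have := hjmin i hi
      omega
  -- fill in by monotonicity: `n ≤ q^j m ≤ L`
  have hqjL : q ^ j * m ≤ L := by
    rcases Nat.eq_zero_or_pos j with hj0 | hjpos
    · subst hj0; simp only [pow_zero, one_mul]; exact hmR.trans hRL
    · have hlt : q ^ (j - 1) * m < n := by
        have := hjmin (j - 1) (by omega)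
        omega
      calc q ^ j * m = q * (q ^ (j - 1) * m) := by
            rw [← mul_assoc, ← pow_succ', Nat.sub_add_cancel hjpos]
        _ ≤ q * n := Nat.mul_le_mul_left q hlt.le
        _ ≤ q * R := Nat.mul_le_mul_left q hnR
        _ ≤ L := hL
  have hmono : g (q ^ j * m) ≤ g n := hanti n (q ^ j * m) (hm.trans hmn) hj hqjL
  -- compare the prefactors: `κ (n/m)^{log_q κ} ≤ κ^j`
  have hkey : κ * ((n : ℝ) / m) ^ Real.logb q κ ≤ κ ^ j := by
    rcases Nat.eq_zero_or_pos j with hj0 | hjpos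
    · subst hj0
      have hnm : n = m := le_antisymm (by simpa using hj) hmn
      rw [pow_zero, hnm, div_self hm0.ne', Real.one_rpow, mul_one]
      exact hκ1
    · have hlt : q ^ (j - 1) * m < n := by
        have := hjmin (j - 1) (by omega)
        omega
      have hle : ((q : ℝ) ^ (j - 1) : ℝ) ≤ (n : ℝ) / m := by
        rw [le_div_iff₀ hm0]; exact_mod_cast hlt.le
      have hqj0 : (0 : ℝ) < (q : ℝ) ^ (j - 1) := by positivity
      have h1 : ((n : ℝ) / m) ^ Real.logb q κ ≤ ((q : ℝ) ^ (j - 1)) ^ Real.logb q κ :=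
        Real.rpow_le_rpow_of_nonpos hqj0 hle hlogb
      have h2 : ((q : ℝ) ^ (j - 1)) ^ Real.logb q κ = κ ^ (j - 1) := by
        rw [← Real.rpow_natCast (q : ℝ) (j - 1), ← Real.rpow_mul hq0.le, mul_comm,
          Real.rpow_mul hq0.le, hqκ, Real.rpow_natCast]
      calc κ * ((n : ℝ) / m) ^ Real.logb q κ ≤ κ * κ ^ (j - 1) := by
            rw [← h2]; exact mul_le_mul_of_nonneg_left h1 hκ.le
        _ = κ ^ j := by rw [← pow_succ', Nat.sub_add_cancel hjpos]
  have hgm : 0 < g m := hpos m hm (hmR.trans hRL)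
  calc κ * ((n : ℝ) / m) ^ Real.logb q κ * g m ≤ κ ^ j * g m :=
        mul_le_mul_of_nonneg_right hkey hgm.le
    _ ≤ g (q ^ j * m) := hiter
    _ ≤ g n := hmono

/-- The threshold `κ > q^{-3/2}` is exactly `ε := 3/2 + log_q κ > 0`, and then
`log_q κ = -(3/2 - ε)`. [folklore] -/
theorem logb_threshold {q : ℕ} {κ : ℝ} (hq : 2 ≤ q) (hκ : 0 < κ)
    (hqκ : (q : ℝ) ^ (-((3 : ℝ) / 2)) < κ) :
    0 < (3 : ℝ) / 2 + Real.logb q κ ∧ Real.logb q κ = -((3 : ℝ) / 2 - (3 / 2 + Real.logb q κ)) := by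
  have hq1 : (1 : ℝ) < q := by exact_mod_cast hq
  refine ⟨?_, by ring⟩
  have : -((3 : ℝ) / 2) < Real.logb q κ := (Real.lt_logb_iff_rpow_lt hq1 hκ).2 hqκ
  linarith

/-! ### Row-feasible functionals -/

/-- The axis two-point values `E{0, n e₁}` of a row-feasible level-`L` functional with `cw > 0`
are positive for `1 ≤ n ≤ L` (window row 8, lower half; `n e₁ ∈ Λ_L` is the landed
`axisSite_mem_box`-type fact, re-derived inline). [folklore] -/
theorem feasible_axis_pos {L : ℕ} {cw Cw : ℝ} {E : Finset (Site 3) → ℝ}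
    (hE : LatticeBootstrapFeasible L cw Cw E) (hcw : 0 < cw) {n : ℕ} (hn : 1 ≤ n) (hnL : n ≤ L) :
    0 < E {0, Pi.single 0 (n : ℤ)} := by
  have hmem : (Pi.single 0 (n : ℤ) : Site 3) ∈ box 3 L := by
    rw [mem_box]
    intro i
    by_cases hi : i = 0
    · subst hi; simp only [Pi.single_eq_same]; omega
    · simp only [Pi.single_eq_of_ne hi]; omega
  exact hE.twoPoint_pos hcw hmem (single_natCast_ne_zero hn)

/-- The axis two-point values of a row-feasible level-`L` functional are antitone on `{1,…,L}`
(Messager–Miracle-Solé axis row 5, iterated). [cite: MessagerMiracleSoleJSP1977, main theorem] -/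
theorem feasible_axis_antitone {L : ℕ} {cw Cw : ℝ} {E : Finset (Site 3) → ℝ}
    (hE : LatticeBootstrapFeasible L cw Cw E) :
    ∀ a b : ℕ, 1 ≤ a → a ≤ b → b ≤ L →
      E {0, Pi.single 0 (b : ℤ)} ≤ E {0, Pi.single 0 (a : ℤ)} := by
  -- one step `E{0,(n+1)e₁} ≤ E{0,n e₁}` for `1 ≤ n`, `n + 1 ≤ L`
  have hmem : ∀ {N n : ℕ}, n ≤ N → (Pi.single 0 (n : ℤ) : Site 3) ∈ box 3 N := by
    intro N n h
    rw [mem_box]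
    intro i
    by_cases hi : i = 0
    · subst hi; simp only [Pi.single_eq_same]; omega
    · simp only [Pi.single_eq_of_ne hi]; omega
  have hstep : ∀ n : ℕ, 1 ≤ n → n + 1 ≤ L →
      E {0, Pi.single 0 ((n + 1 : ℕ) : ℤ)} ≤ E {0, Pi.single 0 (n : ℤ)} := by
    intro n hn hnL
    have he : (Pi.single 0 (n : ℤ) + Pi.single 0 1 : Site 3) = Pi.single 0 ((n + 1 : ℕ) : ℤ) := by
      rw [← Pi.single_add]; push_cast; rfl
    have h := hE.mms_axis (x := Pi.single 0 (n : ℤ)) (i := 0) (single_natCast_ne_zero hn)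
      (by simp) (hmem (by omega)) (by rw [he]; exact hmem hnL)
    rwa [he] at h
  intro a b ha hab hbL
  induction b, hab using Nat.le_induction with
  | base => exact le_rfl
  | succ b hab ih =>
    exact (hstep b (ha.trans hab) hbL).trans (ih (by omega))

/-- **One scale factor gives the window, for a row-feasible functional.** If
`E` is row-feasible at level `L` with `cw > 0`, `q ≥ 2`, `q R ≤ L`, and
`κ E{0, n e₁} ≤ E{0, q n e₁}` for `1 ≤ n ≤ R` (`κ > 0`), then
`κ (n/m)^{log_q κ} E{0, m e₁} ≤ E{0, n e₁}` for all `1 ≤ m ≤ n ≤ R`. [folklore] -/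
theorem feasible_axisWindow_of_oneStep {L q R : ℕ} {cw Cw κ : ℝ} {E : Finset (Site 3) → ℝ}
    (hE : LatticeBootstrapFeasible L cw Cw E) (hcw : 0 < cw) (hq : 2 ≤ q) (hκ : 0 < κ)
    (hL : q * R ≤ L)
    (hstep : ∀ n : ℕ, 1 ≤ n → n ≤ R →
      κ * E {0, Pi.single 0 (n : ℤ)} ≤ E {0, Pi.single 0 ((q * n : ℕ) : ℤ)}) :
    ∀ m n : ℕ, 1 ≤ m → m ≤ n → n ≤ R →
      κ * ((n : ℝ) / m) ^ Real.logb q κ * E {0, Pi.single 0 (m : ℤ)} ≤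
        E {0, Pi.single 0 (n : ℤ)} := by
  set g : ℕ → ℝ := fun n : ℕ => E {0, Pi.single 0 (n : ℤ)} with hg
  have hpos : ∀ n : ℕ, 1 ≤ n → n ≤ L → 0 < g n :=
    fun n hn hnL => feasible_axis_pos hE hcw hn hnL
  have hanti : ∀ a b : ℕ, 1 ≤ a → a ≤ b → b ≤ L → g b ≤ g a := feasible_axis_antitone hE
  have hstep' : ∀ n : ℕ, 1 ≤ n → n ≤ R → κ * g n ≤ g (q * n) :=
    fun n hn hnR => hstep n hn hnR
  intro m n hm hmn hnR
  exact axisWindow_of_oneStep hq hκ hL hpos hanti hstep' m n hm hmn hnR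

/-! ### `CertifiedWindow` ⇔ one scale factor at one relative depth -/

/-- **A single certified scale factor gives `CertifiedWindow`.** Suppose that for all window
constants `cw, Cw > 0` there are an integer `q ≥ 2`, a constant `κ > q^{-3/2}` and a relative
depth `k ≥ q` such that for every `R` and every probability boundary law `ν` whose level-`kR`
functional `E = boundaryLawFunctional 3 (kR) β_c ν` is row-feasible, `κ E{0, n e₁} ≤ E{0, q n e₁}`
for all `1 ≤ n ≤ R`. Then `CertifiedWindow` holds, with `ε = 3/2 + log_q κ`, `c = κ` and the same
`k` (the rows of the route decl ARE `LatticeBootstrapFeasible (kR) cw Cw E`, definitionally).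
[folklore] -/
theorem certifiedWindow_of_oneStep
    (h : ∀ cw Cw : ℝ, 0 < cw → 0 < Cw → ∃ (q : ℕ) (κ : ℝ) (k : ℕ), 2 ≤ q ∧
      (q : ℝ) ^ (-((3 : ℝ) / 2)) < κ ∧ q ≤ k ∧
      ∀ (R : ℕ) (ν : Measure (SpinConfig (Site 3))), IsProbabilityMeasure ν →
        LatticeBootstrapFeasible (k * R) cw Cw
          (boundaryLawFunctional 3 (k * R) (criticalBeta 3) ν) →
        ∀ n : ℕ, 1 ≤ n → n ≤ R →
          κ * boundaryLawFunctional 3 (k * R) (criticalBeta 3) ν {0, Pi.single 0 (n : ℤ)} ≤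
            boundaryLawFunctional 3 (k * R) (criticalBeta 3) ν {0, Pi.single 0 ((q * n : ℕ) : ℤ)}) :
    CertifiedWindow := by
  intro cw Cw hcw hCw
  obtain ⟨q, κ, k, hq, hqκ, hqk, hR⟩ := h cw Cw hcw hCw
  have hq0 : (0 : ℝ) < q := by exact_mod_cast (show 0 < q by omega)
  have hκ : 0 < κ := lt_trans (Real.rpow_pos_of_pos hq0 _) hqκ
  obtain ⟨hε, hexp⟩ := logb_threshold hq hκ hqκ
  refine ⟨3 / 2 + Real.logb q κ, κ, k, hε, hκ, le_trans (by omega) hqk, ?_⟩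
  intro R ν hν hrows m n hm hmn hnR
  have hfeas : LatticeBootstrapFeasible (k * R) cw Cw
      (boundaryLawFunctional 3 (k * R) (criticalBeta 3) ν) := hrows
  have hL : q * R ≤ k * R := Nat.mul_le_mul_right R hqk
  have key := feasible_axisWindow_of_oneStep hfeas hcw hq hκ hL (hR R ν hν hfeas) m n hm hmn hnR
  rw [← hexp]
  exact key

/-- **`CertifiedWindow` gives a certified scale factor.** From `(ε, c, k)` of the crux take an
integer `q ≥ 2` with `c q^ε > 1`, put `κ := c q^{-(3/2-ε)} > q^{-3/2}` and the relative depth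
`k' := k q ≥ q`; at level `k' R = k (q R)` the crux at scale `q R` compares `n` with `q n ≤ q R`.
[folklore] -/
theorem oneStep_of_certifiedWindow (hCW : CertifiedWindow) :
    ∀ cw Cw : ℝ, 0 < cw → 0 < Cw → ∃ (q : ℕ) (κ : ℝ) (k : ℕ), 2 ≤ q ∧
      (q : ℝ) ^ (-((3 : ℝ) / 2)) < κ ∧ q ≤ k ∧
      ∀ (R : ℕ) (ν : Measure (SpinConfig (Site 3))), IsProbabilityMeasure ν →
        LatticeBootstrapFeasible (k * R) cw Cw
          (boundaryLawFunctional 3 (k * R) (criticalBeta 3) ν) →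
        ∀ n : ℕ, 1 ≤ n → n ≤ R →
          κ * boundaryLawFunctional 3 (k * R) (criticalBeta 3) ν {0, Pi.single 0 (n : ℤ)} ≤
            boundaryLawFunctional 3 (k * R) (criticalBeta 3) ν
              {0, Pi.single 0 ((q * n : ℕ) : ℤ)} := by
  intro cw Cw hcw hCw
  obtain ⟨ε, c, k, hε, hc, hk, hR⟩ := hCW cw Cw hcw hCw
  obtain ⟨q₀, hq₀⟩ := exists_nat_gt (c⁻¹ ^ ε⁻¹)
  have hq0 : (0 : ℝ) < ((q₀ + 2 : ℕ) : ℝ) := by positivity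
  refine ⟨q₀ + 2, c * ((q₀ + 2 : ℕ) : ℝ) ^ (-((3 : ℝ) / 2 - ε)), k * (q₀ + 2), by omega, ?_,
    Nat.le_mul_of_pos_left _ (by omega), ?_⟩
  · -- threshold: `q^{-3/2} < c q^{-(3/2-ε)} = (c q^ε) q^{-3/2}` as `c q^ε > 1`
    have hcq : 1 < c * ((q₀ + 2 : ℕ) : ℝ) ^ ε := by
      have hlt : c⁻¹ ^ ε⁻¹ < ((q₀ + 2 : ℕ) : ℝ) := hq₀.trans_le (by push_cast; linarith)
      have h1 : (c⁻¹ ^ ε⁻¹) ^ ε < ((q₀ + 2 : ℕ) : ℝ) ^ ε :=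
        Real.rpow_lt_rpow (by positivity) hlt hε
      rw [Real.rpow_inv_rpow (by positivity) hε.ne'] at h1
      have h2 := mul_lt_mul_of_pos_left h1 hc
      rwa [mul_inv_cancel₀ hc.ne'] at h2
    have hsplit : ((q₀ + 2 : ℕ) : ℝ) ^ (-((3 : ℝ) / 2 - ε)) =
        ((q₀ + 2 : ℕ) : ℝ) ^ ε * ((q₀ + 2 : ℕ) : ℝ) ^ (-((3 : ℝ) / 2)) := by
      rw [← Real.rpow_add hq0]; congr 1; ring
    rw [hsplit, ← mul_assoc]
    have hpos : (0 : ℝ) < ((q₀ + 2 : ℕ) : ℝ) ^ (-((3 : ℝ) / 2)) := Real.rpow_pos_of_pos hq0 _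
    calc ((q₀ + 2 : ℕ) : ℝ) ^ (-((3 : ℝ) / 2))
        = 1 * ((q₀ + 2 : ℕ) : ℝ) ^ (-((3 : ℝ) / 2)) := (one_mul _).symm
      _ < c * ((q₀ + 2 : ℕ) : ℝ) ^ ε * ((q₀ + 2 : ℕ) : ℝ) ^ (-((3 : ℝ) / 2)) :=
          mul_lt_mul_of_pos_right hcq hpos
  · intro R ν hν hrows n hn hnR
    -- level `k (q R)`: the crux at scale `q R` compares `n` with `q n ≤ q R`
    have hlev : k * (q₀ + 2) * R = k * ((q₀ + 2) * R) := by ring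
    rw [hlev] at hrows ⊢
    have hqn : n ≤ (q₀ + 2) * n := Nat.le_mul_of_pos_left n (by omega)
    have key := hR ((q₀ + 2) * R) ν hν hrows n ((q₀ + 2) * n) hn hqn
      (Nat.mul_le_mul_left _ hnR)
    have hn0 : (n : ℝ) ≠ 0 := by exact_mod_cast (show n ≠ 0 by omega)
    have hdiv : (((q₀ + 2) * n : ℕ) : ℝ) / n = ((q₀ + 2 : ℕ) : ℝ) := by
      push_cast; field_simp
    rw [hdiv] at key
    exact key

/-- **`CertifiedWindow` ⇔ one certified scale factor at one relative depth**: the crux holds iff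
for all window constants there are `q ≥ 2`, `κ > q^{-3/2}`, `k ≥ q` such that every row-feasible
level-`kR` boundary-law functional satisfies `κ E{0, n e₁} ≤ E{0, q n e₁}` for `1 ≤ n ≤ R`,
uniformly in `R` and in the boundary law. [folklore] -/
theorem certifiedWindow_iff_oneStep :
    CertifiedWindow ↔
      ∀ cw Cw : ℝ, 0 < cw → 0 < Cw → ∃ (q : ℕ) (κ : ℝ) (k : ℕ), 2 ≤ q ∧
        (q : ℝ) ^ (-((3 : ℝ) / 2)) < κ ∧ q ≤ k ∧
        ∀ (R : ℕ) (ν : Measure (SpinConfig (Site 3))), IsProbabilityMeasure ν →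
          LatticeBootstrapFeasible (k * R) cw Cw
            (boundaryLawFunctional 3 (k * R) (criticalBeta 3) ν) →
          ∀ n : ℕ, 1 ≤ n → n ≤ R →
            κ * boundaryLawFunctional 3 (k * R) (criticalBeta 3) ν {0, Pi.single 0 (n : ℤ)} ≤
              boundaryLawFunctional 3 (k * R) (criticalBeta 3) ν
                {0, Pi.single 0 ((q * n : ℕ) : ℤ)} :=
  ⟨oneStep_of_certifiedWindow, certifiedWindow_of_oneStep⟩

/-! ### The registered stub of the crux skeleton -/

/-- **Registered stub `stub_oneStepCriterion` of the rev-2 skeleton of crux `CertifiedWindow`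
(line `registered` = `Cruxes/CertifiedWindow/Lines/birth.lean`)**: the one-scale-factor criterion,
verbatim the registered signature; proof = `certifiedWindow_of_oneStep`. [folklore] -/
theorem stub_oneStepCriterion : (∀ cw Cw : ℝ, 0 < cw → 0 < Cw → ∃ (q : ℕ) (κ : ℝ) (k : ℕ), 2 ≤ q ∧ (q : ℝ) ^ (-((3 : ℝ) / 2)) < κ ∧ q ≤ k ∧ ∀ (R : ℕ) (ν : MeasureTheory.Measure (Literature.Probability.LatticeModels.SpinConfig (Literature.Probability.LatticeModels.Site 3))), MeasureTheory.IsProbabilityMeasure ν → Literature.Probability.LatticeModels.LatticeBootstrapFeasible (k * R) cw Cw (Literature.Probability.LatticeModels.boundaryLawFunctional 3 (k * R) (Literature.Probability.LatticeModels.criticalBeta 3) ν) → ∀ n : ℕ, 1 ≤ n → n ≤ R → κ * Literature.Probability.LatticeModels.boundaryLawFunctional 3 (k * R) (Literature.Probability.LatticeModels.criticalBeta 3) ν {0, Pi.single 0 (n : ℤ)} ≤ Literature.Probability.LatticeModels.boundaryLawFunctional 3 (k * R) (Literature.Probability.LatticeModels.criticalBeta 3) ν {0, Pi.single 0 ((q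 * n : ℕ) : ℤ)}) → Summit.CriticalPhenomena.Ising3DConformalLimit.Theses.LatticeSDPCertificates.CertifiedWindow :=
  certifiedWindow_of_oneStep

end Summit.CriticalPhenomena.Ising3DConformalLimit.Theorems
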